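import Mathlib
import Summits.Ventures.PercRepro2.HCov
import Summits.Ventures.PercRepro2.RECMReduction
import Summits.Ventures.PercRepro2.CCWReduced
import Summits.Ventures.PercRepro2.GcSkelRules
import Summits.Ventures.PercRepro2.GcSkelReductionT
import Summits.Ventures.PercRepro2.GcSkelReductionO
import Summits.Ventures.PercRepro2.GcSkelReductionOB
import Summits.Ventures.PercRepro2.GcSkelReductionMinOB
import Summits.Ventures.PercRepro2.TwoMarkHubMain

/-!
# The residual minus the pole hub (blind cell PercRepro2, typer-1 g54)

mine-2 g40's `CovForm.THub.HCov_of_poleHub` (TwoMarkHubMain p678130): (HCOV) holds at every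
admissible weight when every edge at `o` and every edge at `b` leads to a mark, at most one to
each pair (`CovForm.THub.IsHub ends o a₁ a₂ a₃ b .ob slot`, spelled out by `isHub_ob`: the seven
optional slot edges `o–a₁, o–a₂, o–a₃, o–b, a₁–b, a₂–b, a₃–b`). Folded into the weighted
residual by the pattern of `GcSkelReductionO.lean`, with the loops at `o` and `b` moved to `a₁`
(`relocate2`, invisible to `Gc`):

* **`PoleHubToMarks ends o a₁ a₂ a₃ b`** — every non-loop edge at `o` or at `b` is one of the seven
  pairs; **`exists_isHub_ob_of_poleHubToMarks`** (on a simple graph the relocated map is a pole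
  hub with the unique edge of each pair as its slot); **`HCov_of_poleHubToMarks`**;
* **`WReducedH`** := `WReducedOB` ∧ ¬ `PoleHubToMarks`; **`HCov_all_iff_HCovWRedH_all`**;
  **`exists_pole_edge_off_of_wredH`** — on the residual `o` or `b` has a non-loop edge to an
  unmarked vertex.

The two `a₃`-hubs (`HCov_of_hubOA3`, `HCov_of_hubBA3`) are already outside the residual: its
clause ¬R₃ gives `a₃` a non-loop edge to an unmarked vertex (mine-2 g40, STATUS 10898).
-/

namespace Summit.Ventures.PercRepro2

open CovForm RECM

namespace WRed

/-! ## Loops at two vertices moved away -/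

section Relocate

variable {V : Type*} {E : Type*} [DecidableEq V]

/-- The loops at `o` and at `b` moved to `a₁`. -/
def relocate2 (ends : E → Sym2 V) (o b a₁ : V) : E → Sym2 V :=
  fun e => if (ends e).IsDiag ∧ (o ∈ ends e ∨ b ∈ ends e) then s(a₁, a₁) else ends e

/-- The relocated map agrees with `ends` on every non-loop edge of `ends`. -/
lemma relocate2_agree (ends : E → Sym2 V) (o b a₁ : V) :
    ∀ g, ¬ (ends g).IsDiag → relocate2 ends o b a₁ g = ends g := by
  intro g hg
  simp [relocate2, hg]

/-- The relocated map agrees with `ends` on every non-loop edge of the relocated map. -/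
lemma relocate2_agree' (ends : E → Sym2 V) (o b a₁ : V) :
    ∀ g, ¬ (relocate2 ends o b a₁ g).IsDiag → relocate2 ends o b a₁ g = ends g := by
  intro g hg
  by_cases h : (ends g).IsDiag ∧ (o ∈ ends g ∨ b ∈ ends g)
  · exfalso
    apply hg
    simp [relocate2, h]
  · simp [relocate2, h]

/-- No loop of the relocated map sits at `o` or at `b` (both `≠ a₁`). -/
lemma not_loop_at_poles_relocate2 {ends : E → Sym2 V} {o b a₁ : V} (ho1 : o ≠ a₁) (hb1 : b ≠ a₁)
    {g : E} (hg : o ∈ relocate2 ends o b a₁ g ∨ b ∈ relocate2 ends o b a₁ g) :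
    ¬ (relocate2 ends o b a₁ g).IsDiag := by
  intro hd
  by_cases h : (ends g).IsDiag ∧ (o ∈ ends g ∨ b ∈ ends g)
  · simp only [relocate2, h, and_self, if_true, Sym2.mem_iff, or_self] at hg
    rcases hg with hg | hg
    · exact ho1 hg
    · exact hb1 hg
  · simp only [relocate2, h, if_false] at hg hd
    exact h ⟨hd, hg⟩

end Relocate

/-! ## The pole-hub class, loops ignored -/

section Class

variable {V : Type*} {E : Type*}

/-- **The pole-hub class, loops ignored**: every non-loop edge at `o` or at `b` is one of the seven
pairs `o–a₁, o–a₂, o–a₃, o–b, a₁–b, a₂–b, a₃–b`. -/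
def PoleHubToMarks (ends : E → Sym2 V) (o a₁ a₂ a₃ b : V) : Prop :=
  ∀ e, ¬ (ends e).IsDiag → (o ∈ ends e ∨ b ∈ ends e) →
    ends e = s(o, a₁) ∨ ends e = s(o, a₂) ∨ ends e = s(o, a₃) ∨ ends e = s(o, b) ∨
      ends e = s(a₁, b) ∨ ends e = s(a₂, b) ∨ ends e = s(a₃, b)

/-- The seven pairs of the pole hub, in the order of mine-2 g40's `isHub_ob`. -/
def poleTargets (o a₁ a₂ a₃ b : V) : Fin 7 → Sym2 V :=
  ![s(o, a₁), s(o, a₂), s(o, a₃), s(o, b), s(a₁, b), s(a₂, b), s(a₃, b)]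

/-- An edge of the class is one of the seven targets. -/
lemma exists_target_of_poleHubToMarks {ends : E → Sym2 V} {o a₁ a₂ a₃ b : V}
    (h : PoleHubToMarks ends o a₁ a₂ a₃ b) {e : E} (hd : ¬ (ends e).IsDiag)
    (he : o ∈ ends e ∨ b ∈ ends e) : ∃ i : Fin 7, ends e = poleTargets o a₁ a₂ a₃ b i := by
  rcases h e hd he with h0 | h1 | h2 | h3 | h4 | h5 | h6
  · exact ⟨0, h0⟩
  · exact ⟨1, h1⟩
  · exact ⟨2, h2⟩
  · exact ⟨3, h3⟩
  · exact ⟨4, h4⟩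
  · exact ⟨5, h5⟩
  · exact ⟨6, h6⟩

end Class

/-! ## The slots from simplicity -/

section Slots

variable {V : Type*} {E : Type*} [DecidableEq V]

open Classical in
/-- **The slots from simplicity**: on a simple graph in the pole-hub class, the relocated map is a
pole hub (`CovForm.THub.IsHub … .ob`) with the unique edge of each pair as its slot. -/
theorem exists_isHub_ob_of_poleHubToMarks {ends : E → Sym2 V} (hsimp : Simple ends)
    {o a₁ a₂ a₃ b : V} (h : PoleHubToMarks ends o a₁ a₂ a₃ b) (h01 : o ≠ a₁) (h02 : o ≠ a₂)
    (h03 : o ≠ a₃) (h04 : o ≠ b) (h12 : a₁ ≠ a₂) (h13 : a₁ ≠ a₃) (h14 : a₁ ≠ b) (h23 : a₂ ≠ a₃)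
    (h24 : a₂ ≠ b) (h34 : a₃ ≠ b) :
    ∃ slot : Fin 7 → Option E,
      CovForm.THub.IsHub (relocate2 ends o b a₁) o a₁ a₂ a₃ b .ob slot := by
  -- the targets are non-loops
  have hT : ∀ i : Fin 7, ¬ (poleTargets o a₁ a₂ a₃ b i).IsDiag := by
    intro i
    fin_cases i <;> simp [poleTargets, Sym2.mk_isDiag_iff, h01, h02, h03, h04, h14, h24, h34]
  let slot : Fin 7 → Option E := fun i =>
    if hi : ∃ e, ends e = poleTargets o a₁ a₂ a₃ b i then some (Classical.choose hi) else none
  have hslot : ∀ i e, slot i = some e → relocate2 ends o b a₁ e = poleTargets o a₁ a₂ a₃ b i := by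
    intro i e he
    simp only [slot] at he
    split_ifs at he with hi
    · have hc := Classical.choose_spec hi
      rw [Option.some_inj] at he
      subst he
      rw [relocate2_agree ends o b a₁ _ (by rw [hc]; exact hT i)]
      exact hc
  have hall : ∀ e, o ∈ relocate2 ends o b a₁ e ∨ b ∈ relocate2 ends o b a₁ e →
      ∃ i, slot i = some e := by
    intro e he
    have hnd := not_loop_at_poles_relocate2 h01 h14.symm he
    rw [relocate2_agree' ends o b a₁ e hnd] at he hnd
    obtain ⟨i, hi⟩ := exists_target_of_poleHubToMarks h hnd he
    refine ⟨i, ?_⟩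
    have hex : ∃ e', ends e' = poleTargets o a₁ a₂ a₃ b i := ⟨e, hi⟩
    simp only [slot, dif_pos hex]
    congr 1
    by_contra hne
    exact hsimp _ _ (Ne.symm hne) (by rw [hi]; exact hT i) (by rw [hi, Classical.choose_spec hex])
  refine ⟨slot, CovForm.THub.isHub_ob (hslot 0) (hslot 1) (hslot 2) (hslot 3) (hslot 4) (hslot 5)
    (hslot 6) hall h01 h02 h03 h04 h12 h13 h14 h23 h24 h34⟩

end Slots

/-! ## (HCOV) on the class, and the residual minus it -/

section Main

variable {V : Type*} {E : Type*} [Fintype E] [DecidableEq E] [DecidableEq V]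

/-- **(HCOV) on the loop-ignored pole-hub class of a simple graph**, through mine-2 g40's
`HCov_of_poleHub`. -/
theorem HCov_of_poleHubToMarks {R : Type*} [Field R] [LinearOrder R] [IsStrictOrderedRing R]
    {ends : E → Sym2 V} (hsimp : Simple ends) {o a₁ a₂ a₃ b : V}
    (h : PoleHubToMarks ends o a₁ a₂ a₃ b) (h01 : o ≠ a₁) (h02 : o ≠ a₂) (h03 : o ≠ a₃)
    (h04 : o ≠ b) (h12 : a₁ ≠ a₂) (h13 : a₁ ≠ a₃) (h14 : a₁ ≠ b) (h23 : a₂ ≠ a₃) (h24 : a₂ ≠ b)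
    (h34 : a₃ ≠ b) (p : E → R) (hp : IsProbVec p) : HCov p ends o a₁ a₂ a₃ b := by
  obtain ⟨slot, hH⟩ :=
    exists_isHub_ob_of_poleHubToMarks hsimp h h01 h02 h03 h04 h12 h13 h14 h23 h24 h34
  unfold HCov
  rw [Gc_eq_of_agree_nonLoop p (relocate2_agree ends o b a₁) (relocate2_agree' ends o b a₁)]
  exact CovForm.THub.HCov_of_poleHub hH p hp

/-- **The residual minus the pole hub**: `WReducedOB`, and `o` or `b` has a non-loop edge to an
unmarked vertex. -/
structure WReducedH (ends : E → Sym2 V) (o a₁ a₂ a₃ b : V) : Prop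
    extends WReducedOB ends o a₁ a₂ a₃ b where
  /-- not the pole-hub class -/
  notPoleHub : ¬ PoleHubToMarks ends o a₁ a₂ a₃ b

omit [Fintype E] [DecidableEq E] [DecidableEq V] in
/-- The ends of a non-loop edge at `o` or `b` that is none of the seven pairs: one end is a pole,
the other is no mark. -/
lemma exists_unmarked_end_of_not_target {ends : E → Sym2 V} {o a₁ a₂ a₃ b : V} {e : E}
    (hd : ¬ (ends e).IsDiag) (he : o ∈ ends e ∨ b ∈ ends e)
    (hne : ¬ (ends e = s(o, a₁) ∨ ends e = s(o, a₂) ∨ ends e = s(o, a₃) ∨ ends e = s(o, b) ∨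
      ends e = s(a₁, b) ∨ ends e = s(a₂, b) ∨ ends e = s(a₃, b))) :
    ∃ x, (ends e = s(o, x) ∨ ends e = s(b, x)) ∧ Unmarked o a₁ a₂ a₃ b x := by
  rcases he with ho | hb
  · obtain ⟨x, hx⟩ := Sym2.mem_iff_exists.mp ho
    refine ⟨x, Or.inl hx, ?_⟩
    have hxo : x ≠ o := by
      intro hxo
      rw [hx, hxo, Sym2.mk_isDiag_iff] at hd
      exact hd rfl
    refine ⟨hxo, fun h1 => hne (Or.inl (by rw [hx, h1])),
      fun h2 => hne (Or.inr (Or.inl (by rw [hx, h2]))),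
      fun h3 => hne (Or.inr (Or.inr (Or.inl (by rw [hx, h3])))),
      fun hb' => hne (Or.inr (Or.inr (Or.inr (Or.inl (by rw [hx, hb'])))))⟩
  · obtain ⟨x, hx⟩ := Sym2.mem_iff_exists.mp hb
    refine ⟨x, Or.inr hx, ?_⟩
    have hxb : x ≠ b := by
      intro hxb
      rw [hx, hxb, Sym2.mk_isDiag_iff] at hd
      exact hd rfl
    refine ⟨fun ho' => hne (Or.inr (Or.inr (Or.inr (Or.inl (by rw [hx, ho', Sym2.eq_swap]))))),
      fun h1 => hne (Or.inr (Or.inr (Or.inr (Or.inr (Or.inl (by rw [hx, h1, Sym2.eq_swap])))))),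
      fun h2 => hne (Or.inr (Or.inr (Or.inr (Or.inr (Or.inr (Or.inl
        (by rw [hx, h2, Sym2.eq_swap]))))))),
      fun h3 => hne (Or.inr (Or.inr (Or.inr (Or.inr (Or.inr (Or.inr
        (by rw [hx, h3, Sym2.eq_swap]))))))), hxb⟩

omit [DecidableEq E] in
/-- **On the residual `o` or `b` has a non-loop edge to an unmarked vertex.** -/
theorem exists_pole_edge_off_of_wredH {ends : E → Sym2 V} {o a₁ a₂ a₃ b : V}
    (h : WReducedH ends o a₁ a₂ a₃ b) :
    ∃ (e : E) (x : V), (ends e = s(o, x) ∨ ends e = s(b, x)) ∧ Unmarked o a₁ a₂ a₃ b x := by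
  by_contra hc
  push Not at hc
  apply h.notPoleHub
  intro e hd he
  by_contra hne
  obtain ⟨x, hx, hux⟩ := exists_unmarked_end_of_not_target hd he hne
  exact hc e x hx hux

end Main

section Closure

variable (R : Type*) [Field R] [LinearOrder R] [IsStrictOrderedRing R]

/-- **(HCOV) on the residual minus the pole hub**. -/
def HCovWRedH_all : Prop :=
  ∀ (V E : Type) [Fintype V] [DecidableEq V] [Fintype E] [DecidableEq E]
    (ends : E → Sym2 V) (p : E → R), IsProbVec p →
    ∀ o a₁ a₂ a₃ b : V, a₁ ≠ a₂ → a₁ ≠ a₃ → a₂ ≠ a₃ → o ≠ a₁ → o ≠ a₂ → o ≠ a₃ → o ≠ b →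
      b ≠ a₁ → b ≠ a₂ → b ≠ a₃ → WReducedH ends o a₁ a₂ a₃ b → HCov p ends o a₁ a₂ a₃ b

end Closure

section Iff

variable {R : Type*} [Field R] [LinearOrder R] [IsStrictOrderedRing R]

/-- The pole-hub class is a theorem on the residual: no induction. -/
theorem HCovWRedOB_all_of_HCovWRedH_all (hB : HCovWRedH_all R) : HCovWRedOB_all R := by
  intro V E _ _ _ _ ends p hp o a₁ a₂ a₃ b h12 h13 h23 ho1 ho2 ho3 hob hb1 hb2 hb3 hred
  by_cases hH : PoleHubToMarks ends o a₁ a₂ a₃ b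
  · exact HCov_of_poleHubToMarks hred.simple hH ho1 ho2 ho3 hob h12 h13 hb1.symm h23 hb2.symm
      hb3.symm p hp
  · exact hB V E ends p hp o a₁ a₂ a₃ b h12 h13 h23 ho1 ho2 ho3 hob hb1 hb2 hb3 ⟨hred, hH⟩

/-- **THE WEIGHTED RESIDUAL MINUS THE POLE HUB**: (HCOV) for every finite weighted graph with five
distinct marks follows from (HCOV) on `WReducedH`. -/
theorem HCov_all_of_HCovWRedH_all (hB : HCovWRedH_all R) : HCov_all R :=
  HCov_all_of_HCovWRedOB_all (HCovWRedOB_all_of_HCovWRedH_all hB)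

/-- The residual minus the pole hub is a faithful reduction. -/
theorem HCov_all_iff_HCovWRedH_all : HCov_all R ↔ HCovWRedH_all R :=
  ⟨fun h V E _ _ _ _ ends p hp o a₁ a₂ a₃ b h12 h13 h23 ho1 ho2 ho3 hob hb1 hb2 hb3 _ =>
    h V E ends p hp o a₁ a₂ a₃ b h12 h13 h23 ho1 ho2 ho3 hob hb1 hb2 hb3,
   HCov_all_of_HCovWRedH_all⟩

/-- The residuals are equivalent closures. -/
theorem HCovWRedOB_all_iff_HCovWRedH_all : HCovWRedOB_all R ↔ HCovWRedH_all R := by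
  rw [← HCov_all_iff_HCovWRedOB_all, ← HCov_all_iff_HCovWRedH_all]

end Iff

end WRed

end Summit.Ventures.PercRepro2
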